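import Literature.MathematicalPhysics.QuantumFieldTheory.Balaban1983to89.B6Prop22HolderTwoLevelBox
import Literature.MathematicalPhysics.QuantumFieldTheory.Balaban1983to89.B4Thm19ZeroBoxHolderDual

/-!
# `Balaban1983to89.B6Ineq243HolderDualTwoLevelBox` — [B6] (2.42)–(2.43): the COLUMN (adjoint) Hölder clause for the
genuine two-level cube propagator `G′(□)` — the Hölder quotient in `x` of the kernel of `G′(□)∇*`, uniformly in the mesh
(file 13 of the two-level parametrix: the cube-level input of the fifth entry `‖ζG′∇*λ‖_α` of Proposition 2.2 (2.67);
nothing existing is touched; no fact is minted)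

FRAMING (verbatim cell line):
statement-level skeleton of published theorems with citation tags; proofs where landed; nothing here is a claim about the Yang–Mills mass gap

Source under audit (cell pub-balaban): T. Bałaban, *Propagators and renormalization transformations for lattice gauge
theories. II*, Commun. Math. Phys. **96** (1984) 223–250 [`Balaban1984PropagatorsII`, "B6"], p. 230 [PDF 8] (2.42)–(2.43)
and «Properties of the operators G_j(□), G_j(□)Q_j^*, C^{(j)}(□) are described in Lemmas 2.2, 2.4, Proposition 2.3 [3]»,
p. 234 [PDF 12] Proposition 2.2 (2.67) (fifth entry `‖ζ(∇G′)λ‖_α, ‖ζ(G′∇*)λ‖_α ≤ O(1)(L^jη)^{1−α}(‖ζ‖_α + |ζ|)e^{−δ₁dist}|λ|`)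
and «The similar inequalities hold for a derivative of G′λ and for a Hölder norm of a derivative».  [3] =
[`Balaban1983RegularityDecay`]: the column companion of Theorem (1.9) for boxes is `B4Thm19ZeroBoxHolderDual` (this
package; not printed in [3], proved by [3]'s route — see that file and HOME/GAPS.md G-B6-21).

## WHAT THIS FILE CERTIFIES (kernel-checked; `A = 0`)

With `G′(□) = G + a_j²ξ^{d+1}·G·(𝟙_{B(Λ)}^†C𝟙_{B(Λ)})·G` ((2.42), `B6Ineq243TwoLevelBox.gTwoLevel`), `G = G_j(□)`: the mixed
difference (two distant ROWS `x, x′`, unit difference in the COLUMN) of a product factorises,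
`((GB)(x′,fwd z) − (GB)(x′,z)) − ((GB)(x,fwd z) − (GB)(x,z)) = Σ_y (G(x′,y) − G(x,y))·((B)(y,fwd z) − B(y,z))`
(`row_sub_colDiff_add_smul_mul`), so the column Hölder functional of `G′(□)` is bounded by that of `G`
(`B4Thm19ZeroBoxHolderDual.thm19Dual_zero_box_roww_coeff`) plus the Hölder-weighted LONG row difference of `G`
(`wsum2_longRow_holder_le`: telescoping for `|x′−x| < n`, two row norms for `|x′−x| ≥ n`) times the weighted rows of the
column-differenced middle factor (`B4Lemma22ZeroBoxDerivDual.lemma22_zero_box_Gdstar_roww_coeff`, `roww_mid_le`):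
`gTwoLevel_holderDual_wsum2_le` (deterministic), **`ineq243_twoLevel_holderDual_wsum2`** (uniform in the mesh, every
`Λ`, every window point, all `x ≠ x′`, `0 ≤ α < 1`).  HONEST LABEL: (2.43) prints value/derivative clauses; this is the
column-Hölder companion the fifth entry of (2.67) consumes, obtained «from these and (2.42)».

Value = kernel certificate of the cube-level input of [B6] (2.67)₅ at `A = 0`; NOT summit progress (the Yang–Mills
statements are untouched).
-/

namespace Literature.MathematicalPhysics.QuantumFieldTheory.Balaban1983to89.B6Ineq243HolderDualTwoLevelBox

open Finset Matrix
open Literature.MathematicalPhysics.QuantumFieldTheory.Balaban1983to89.B4ContourShift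
open Literature.MathematicalPhysics.QuantumFieldTheory.Balaban1983to89.B4Reflection242
open Literature.MathematicalPhysics.QuantumFieldTheory.Balaban1983to89.B4Green242Bridge
open Literature.MathematicalPhysics.QuantumFieldTheory.Balaban1983to89.B4BoxCov237
open Literature.MathematicalPhysics.QuantumFieldTheory.Balaban1983to89.B4Thm110ZeroBox
open Literature.MathematicalPhysics.QuantumFieldTheory.Balaban1983to89.B4Thm110ZeroBoxDeriv
open Literature.MathematicalPhysics.QuantumFieldTheory.Balaban1983to89.B4Thm19ZeroBoxHolder
open Literature.MathematicalPhysics.QuantumFieldTheory.Balaban1983to89.B4Lemma22ZeroBoxDerivDual (fwd fwd_eq_of_nbr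
  lemma22_zero_box_Gdstar_roww_coeff)
open Literature.MathematicalPhysics.QuantumFieldTheory.Balaban1983to89.B4Thm19ZeroBoxHolderDual
  (thm19Dual_zero_box_roww_coeff)
open Literature.MathematicalPhysics.QuantumFieldTheory.Balaban1983to89.B6Ineq243TwoLevelBox
open Literature.MathematicalPhysics.QuantumFieldTheory.Balaban1983to89.B6Ineq243HolderTwoLevelBox (wsum2_vecMul_le)
open Literature.MathematicalPhysics.QuantumFieldTheory.Balaban1983to89.B6Prop22HolderTwoLevelBox (wsum_longDiff_le)
open B4StripSumsHolder (one_le_supNorm)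
open B4Sect5Proof (latticeConst latticeConst_nonneg)

noncomputable section

variable {d : ℕ}

/-! ## §1 Tools: the mixed difference of `G + c·G·B`, column differences of products, the weighted long row difference -/

section Tools

variable {N : Fin (d + 1) → ℕ}

/-- the mixed (two rows / two columns) difference of `G + c·G·B`, with a weight `W` and a scale `t`:
`W·t·dd(G + cGB) = W·t·ddG + c·Σ_y (W(G(x′,y) − G(x,y)))·(t(B(y,z₁) − B(y,z₂)))`.
[cite: Balaban1984PropagatorsII, (2.42)–(2.43) p.230, bookkeeping] -/
theorem row_sub_colDiff_add_smul_mul (G B : Matrix ↥(boxDom N) ↥(boxDom N) ℝ) (c W t : ℝ)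
    (x' x z₁ z₂ : ↥(boxDom N)) :
    W * (t * (((G + c • (G * B)) x' z₁ - (G + c • (G * B)) x' z₂)
        - ((G + c • (G * B)) x z₁ - (G + c • (G * B)) x z₂)))
      = W * (t * ((G x' z₁ - G x' z₂) - (G x z₁ - G x z₂)))
        + c * ∑ y, (W * (G x' y - G x y)) * (t * (B y z₁ - B y z₂)) := by
  simp only [Matrix.add_apply, Matrix.smul_apply, Matrix.mul_apply, smul_eq_mul]
  have : ∑ y, (W * (G x' y - G x y)) * (t * (B y z₁ - B y z₂))
      = W * (t * ((∑ y, G x' y * B y z₁ - ∑ y, G x' y * B y z₂) - (∑ y, G x y * B y z₁ - ∑ y, G x y * B y z₂))) := by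
    rw [← Finset.sum_sub_distrib, ← Finset.sum_sub_distrib, ← Finset.sum_sub_distrib, Finset.mul_sum,
      Finset.mul_sum]
    exact Finset.sum_congr rfl fun y _ => by ring
  rw [this]
  ring

/-- the column-differenced kernel of a product: `t((AD)(y,fwd z) − (AD)(y,z)) = Σ_w A(y,w)·t(D(w,fwd z) − D(w,z))`.
[cite: Balaban1983RegularityDecay, p. 583 (2.40), dictionary] -/
theorem colDiff_mul (A D : Matrix ↥(boxDom N) ↥(boxDom N) ℝ) (t : ℝ) (μ : Fin (d + 1)) :
    (Matrix.of fun y z => t * ((A * D) y (fwd N μ z) - (A * D) y z))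
      = A * Matrix.of fun w z => t * (D w (fwd N μ z) - D w z) := by
  ext y z
  simp only [Matrix.of_apply, Matrix.mul_apply]
  rw [← Finset.sum_sub_distrib, Finset.mul_sum]
  exact Finset.sum_congr rfl fun w _ => by ring

/-- `wsum` of a scaled function. [folklore] -/
private theorem wsum_smul_abs_le {δ : ℝ} (n : ℕ) (x : ↥(boxDom N)) {W : ℝ} (hW0 : 0 ≤ W) (hW1 : W ≤ 1)
    (g : ↥(boxDom N) → ℝ) : wsum δ n x (fun z => W * g z) ≤ wsum δ n x g := by
  rw [wsum_mul_left _ _ _ hW0]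
  exact mul_le_of_le_one_left (wsum_nonneg _ _ _ _) hW1

/-- **THE HÖLDER-WEIGHTED LONG ROW DIFFERENCE OF A KERNEL, TWO-CENTRE FORM**: if the weighted rows of `T` are `≤ c₀` and
the `n`-scaled nearest-neighbour differenced rows have weighted sums `≤ c_d`, then for `x′ ≠ x`
`Σ_z (n/|x′−x|_∞)^α|T(x′,z) − T(x,z)|e^{δmin(|x−z|,|x′−z|)/n} ≤ 2c₀ + (d+1)e^{δ}c_d` (`0 ≤ α ≤ 1`): for `|x′−x| ≥ n` the
weight is `≤ 1` and the two rows are summed separately; for `|x′−x| < n` the difference is telescoped along a lattice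
path (`B6Prop22HolderTwoLevelBox.wsum_longDiff_le`) and `(n/s)^α·(s/n) ≤ 1`.
[cite: Balaban1984PropagatorsII, (2.43) p.230, (2.67) p.234, bookkeeping] -/
theorem wsum2_longRow_holder_le {δ : ℝ} (hδ : 0 ≤ δ) {n : ℕ} (hn : 1 ≤ n) (T : Matrix ↥(boxDom N) ↥(boxDom N) ℝ)
    {c₀ cd : ℝ} (hc₀ : 0 ≤ c₀) (hcd : 0 ≤ cd) (hrow : ∀ y, roww δ n T y ≤ c₀)
    (hdiff : ∀ (i : Fin (d + 1)) (u ue : ↥(boxDom N)), ue.1 = u.1 + Pi.single i 1 →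
      wsum δ n u (fun c => (n : ℝ) * (T ue c - T u c)) ≤ cd)
    {α : ℝ} (hα0 : 0 ≤ α) (hα1 : α ≤ 1) (x x' : ↥(boxDom N)) (hne : x'.1 ≠ x.1) :
    wsum2 δ n x x' (fun z => ((n : ℝ) / supNorm (x'.1 - x.1)) ^ α * (T x' z - T x z))
      ≤ 2 * c₀ + ((d : ℝ) + 1) * Real.exp δ * cd := by
  have hn' : (0 : ℝ) < n := by exact_mod_cast hn
  have hs1 : 1 ≤ supNorm (x'.1 - x.1) := one_le_supNorm (sub_ne_zero.2 hne)
  have hs0 : 0 < supNorm (x'.1 - x.1) := lt_of_lt_of_le one_pos hs1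
  set W : ℝ := ((n : ℝ) / supNorm (x'.1 - x.1)) ^ α with hW
  have hW0 : 0 ≤ W := Real.rpow_nonneg (div_nonneg hn'.le hs0.le) α
  have hpos2 : 0 ≤ ((d : ℝ) + 1) * Real.exp δ * cd := by positivity
  rcases le_or_gt (n : ℝ) (supNorm (x'.1 - x.1)) with hfar | hnear
  · -- FAR: `W ≤ 1`, split into the two rows
    have hW1 : W ≤ 1 := by
      rw [hW]
      exact Real.rpow_le_one (div_nonneg hn'.le hs0.le) ((div_le_one hs0).2 hfar) hα0
    have hsplit := wsum2_split_le hδ n x x' (fun z => W * (T x' z - T x z)) (fun z => W * (-T x z))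
      (fun z => W * T x' z) (fun z => by ring)
    have h1 : wsum δ n x (fun z => W * (-T x z)) ≤ c₀ := by
      refine (wsum_smul_abs_le n x hW0 hW1 _).trans ?_
      have : wsum δ n x (fun z => -T x z) = roww δ n T x := by
        unfold wsum roww
        exact Finset.sum_congr rfl fun z _ => by rw [abs_neg]
      rw [this]
      exact hrow x
    have h2 : wsum δ n x' (fun z => W * T x' z) ≤ c₀ := by
      refine (wsum_smul_abs_le n x' hW0 hW1 _).trans ?_
      have : wsum δ n x' (fun z => T x' z) = roww δ n T x' := rfl
      rw [this]
      exact hrow x'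
    linarith
  · -- NEAR: telescoping, `W·(d+1)s·e^{δ}c_d/n ≤ (d+1)e^{δ}c_d`
    have hle := wsum2_le_wsum_left hδ n x x' (fun z => W * (T x' z - T x z))
    rw [wsum_mul_left _ _ _ hW0] at hle
    have hlong := wsum_longDiff_le hδ hn T hcd hdiff x x' (le_of_lt hnear)
    have hexp : Real.exp (δ * (n : ℝ) / n) = Real.exp δ := by rw [mul_div_assoc, div_self hn'.ne', mul_one]
    rw [hexp] at hlong
    -- `W·s ≤ n`
    have hWs : W * supNorm (x'.1 - x.1) ≤ n := by
      have h1 : 1 ≤ (n : ℝ) / supNorm (x'.1 - x.1) := by rw [le_div_iff₀ hs0, one_mul]; exact hnear.le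
      have h2 : W ≤ (n : ℝ) / supNorm (x'.1 - x.1) := by
        rw [hW]
        calc ((n : ℝ) / supNorm (x'.1 - x.1)) ^ α ≤ ((n : ℝ) / supNorm (x'.1 - x.1)) ^ (1 : ℝ) :=
              Real.rpow_le_rpow_of_exponent_le h1 hα1
          _ = _ := Real.rpow_one _
      calc W * supNorm (x'.1 - x.1) ≤ (n : ℝ) / supNorm (x'.1 - x.1) * supNorm (x'.1 - x.1) :=
            mul_le_mul_of_nonneg_right h2 hs0.le
        _ = n := div_mul_cancel₀ _ hs0.ne'
    calc wsum2 δ n x x' (fun z => W * (T x' z - T x z))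
        ≤ W * wsum δ n x (fun z => T x' z - T x z) := hle
      _ ≤ W * ((d + 1) * supNorm (x'.1 - x.1) * (Real.exp δ * cd / n)) := mul_le_mul_of_nonneg_left hlong hW0
      _ = (W * supNorm (x'.1 - x.1)) / n * (((d : ℝ) + 1) * Real.exp δ * cd) := by
          field_simp
      _ ≤ 1 * (((d : ℝ) + 1) * Real.exp δ * cd) :=
          mul_le_mul_of_nonneg_right ((div_le_one hn').2 hWs) hpos2
      _ ≤ 2 * c₀ + ((d : ℝ) + 1) * Real.exp δ * cd := by linarith

end Tools

/-! ## §2 The deterministic assembly through (2.42) -/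

set_option maxHeartbeats 800000 in
/-- **THE COLUMN HÖLDER FUNCTIONAL OF `G′(□)` THROUGH (2.42)**: with `G′ = G + a_j²ξ^{d+1}G·B`, `B = 𝟙^†C𝟙·G`, the
mixed difference (rows `x, x′`, columns `fwd z, z`) is that of `G` plus `a_j²ξ^{d+1}Σ_y(G(x′,y) − G(x,y))·(B(y,fwd z) − B(y,z))`,
and the column-differenced `B` is `𝟙^†C𝟙` times the column-differenced `G`; hence
`wsum2 ≤ c₁ + a_j²·c_L·(ce^{δ′}K·c₂)`. [cite: Balaban1984PropagatorsII, (2.42)–(2.43) p.230, (2.67) p.234] -/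
theorem gTwoLevel_holderDual_wsum2_le {n ℓ : ℕ} (hn : 1 ≤ n) (aj a m2 : ℝ) {M' : Fin (d + 1) → ℕ}
    (Λ : Finset ↥(boxDom (fun i => (ℓ + 1) * M' i))) (μ : Fin (d + 1)) {c₂ c₁ cL δ c δ' δ₁ δ₂ : ℝ}
    (hc₂ : 0 ≤ c₂) (hc : 0 ≤ c) (hδ : 0 < δ) (hδ'0 : 0 ≤ δ') (hδ'1 : δ' ≤ δ₁) (hδ'3 : δ' ≤ δ₂)
    (hδ'2 : δ' ≤ δ / 2)
    (hGd : ∀ y, roww δ₂ n (Matrix.of fun w z => (n : ℝ) *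
      ((boxOpR n aj m2 (fun i => (ℓ + 1) * M' i))⁻¹ w (fwd _ μ z)
        - (boxOpR n aj m2 (fun i => (ℓ + 1) * M' i))⁻¹ w z)) y ≤ c₂)
    (hC : ∀ y y' : ↥Λ, |cΛ n ℓ aj a m2 M' Λ y y'| ≤ c * Real.exp (-(δ * supNorm (y.1.1 - y'.1.1))))
    (W : ℝ) (x x' : ↥(boxDom (fun i => n * ((ℓ + 1) * M' i))))
    (hL : wsum2 δ' n x x' (fun y => W * ((boxOpR n aj m2 (fun i => (ℓ + 1) * M' i))⁻¹ x' y
        - (boxOpR n aj m2 (fun i => (ℓ + 1) * M' i))⁻¹ x y)) ≤ cL)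
    (hD : wsum2 δ₁ n x x' (fun z => W * ((n : ℝ) * (((boxOpR n aj m2 (fun i => (ℓ + 1) * M' i))⁻¹ x' (fwd _ μ z)
        - (boxOpR n aj m2 (fun i => (ℓ + 1) * M' i))⁻¹ x' z) - ((boxOpR n aj m2 (fun i => (ℓ + 1) * M' i))⁻¹ x (fwd _ μ z)
        - (boxOpR n aj m2 (fun i => (ℓ + 1) * M' i))⁻¹ x z)))) ≤ c₁) :
    wsum2 δ' n x x' (fun z => W * ((n : ℝ) * ((gTwoLevel n ℓ aj a m2 M' Λ x' (fwd _ μ z) - gTwoLevel n ℓ aj a m2 M' Λ x' z)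
        - (gTwoLevel n ℓ aj a m2 M' Λ x (fwd _ μ z) - gTwoLevel n ℓ aj a m2 M' Λ x z))))
      ≤ c₁ + aj ^ 2 * (cL * ((c * Real.exp δ' * latticeConst (d + 1) (δ / 2)) * c₂)) := by
  have hn' : (0 : ℝ) < n := by exact_mod_cast hn
  have hnD : (0 : ℝ) < ((n : ℝ)) ^ (d + 1) := by positivity
  have hc₁ : 0 ≤ c₁ := (wsum2_nonneg _ _ _ _ _).trans hD
  have hcL : 0 ≤ cL := (wsum2_nonneg _ _ _ _ _).trans hL
  have hGdrow : ∀ y, roww δ' n (Matrix.of fun w z => (n : ℝ) *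
      ((boxOpR n aj m2 (fun i => (ℓ + 1) * M' i))⁻¹ w (fwd _ μ z)
        - (boxOpR n aj m2 (fun i => (ℓ + 1) * M' i))⁻¹ w z)) y ≤ c₂ :=
    fun y => (roww_mono hδ'3 n _ y).trans (hGd y)
  have hmid : ∀ z, roww δ' n ((indBΛ n Λ)ᵀ * cΛ n ℓ aj a m2 M' Λ * indBΛ n Λ) z
      ≤ c * Real.exp δ' * (((n : ℝ)) ^ (d + 1) * latticeConst (d + 1) (δ / 2)) :=
    fun z => roww_mid_le hn Λ hc hδ hδ'0 hδ'2 hC z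
  have hK0 : 0 ≤ c * Real.exp δ' * (((n : ℝ)) ^ (d + 1) * latticeConst (d + 1) (δ / 2)) := by
    have := latticeConst_nonneg (d + 1) (half_pos hδ).le
    positivity
  have hD' : wsum2 δ' n x x' (fun z => W * ((n : ℝ) * (((boxOpR n aj m2 (fun i => (ℓ + 1) * M' i))⁻¹ x' (fwd _ μ z)
        - (boxOpR n aj m2 (fun i => (ℓ + 1) * M' i))⁻¹ x' z) - ((boxOpR n aj m2 (fun i => (ℓ + 1) * M' i))⁻¹ x (fwd _ μ z)
        - (boxOpR n aj m2 (fun i => (ℓ + 1) * M' i))⁻¹ x z)))) ≤ c₁ := (wsum2_mono_rate hδ'1 n x x' _).trans hD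
  have hassoc : gTwoLevel n ℓ aj a m2 M' Λ = (boxOpR n aj m2 (fun i => (ℓ + 1) * M' i))⁻¹
      + (aj ^ 2 * (((n : ℝ)) ^ (d + 1))⁻¹) • ((boxOpR n aj m2 (fun i => (ℓ + 1) * M' i))⁻¹
        * ((indBΛ n Λ)ᵀ * cΛ n ℓ aj a m2 M' Λ * indBΛ n Λ * (boxOpR n aj m2 (fun i => (ℓ + 1) * M' i))⁻¹)) := by
    unfold gTwoLevel
    simp only [Matrix.mul_assoc]
  simp_rw [hassoc, row_sub_colDiff_add_smul_mul]
  set G := (boxOpR n aj m2 (fun i => (ℓ + 1) * M' i))⁻¹ with hGdef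
  set B := (indBΛ n Λ)ᵀ * cΛ n ℓ aj a m2 M' Λ * indBΛ n Λ * G with hBdef
  -- the column-differenced `B` is the middle factor times the column-differenced `G`
  have hBcol : (Matrix.of fun (y : ↥(boxDom (fun i => n * ((ℓ + 1) * M' i))))
        (z : ↥(boxDom (fun i => n * ((ℓ + 1) * M' i)))) => (n : ℝ) * (B y (fwd _ μ z) - B y z))
      = ((indBΛ n Λ)ᵀ * cΛ n ℓ aj a m2 M' Λ * indBΛ n Λ) *
          Matrix.of fun w z => (n : ℝ) * (G w (fwd _ μ z) - G w z) := by
    rw [hBdef]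
    exact colDiff_mul _ G (n : ℝ) μ
  have hBrow : ∀ y, roww δ' n (Matrix.of fun (y : ↥(boxDom (fun i => n * ((ℓ + 1) * M' i))))
        (z : ↥(boxDom (fun i => n * ((ℓ + 1) * M' i)))) => (n : ℝ) * (B y (fwd _ μ z) - B y z)) y
      ≤ c * Real.exp δ' * (((n : ℝ)) ^ (d + 1) * latticeConst (d + 1) (δ / 2)) * c₂ := by
    intro y
    rw [hBcol]
    exact (roww_mul_le hδ'0 n _ _ hGdrow y).trans (mul_le_mul_of_nonneg_right (hmid y) hc₂)
  have hvm : wsum2 δ' n x x' (fun z => ∑ y, (W * (G x' y - G x y)) * ((n : ℝ) * (B y (fwd _ μ z) - B y z)))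
      ≤ cL * (c * Real.exp δ' * (((n : ℝ)) ^ (d + 1) * latticeConst (d + 1) (δ / 2)) * c₂) := by
    have h := wsum2_vecMul_le hδ'0 n x x' (fun y => W * (G x' y - G x y))
      (Matrix.of fun (y : ↥(boxDom (fun i => n * ((ℓ + 1) * M' i))))
        (z : ↥(boxDom (fun i => n * ((ℓ + 1) * M' i)))) => (n : ℝ) * (B y (fwd _ μ z) - B y z)) hBrow
    simp only [Matrix.of_apply] at h
    exact h.trans (mul_le_mul_of_nonneg_right hL (mul_nonneg hK0 hc₂))
  calc wsum2 δ' n x x' (fun z => W * ((n : ℝ) * ((G x' (fwd _ μ z) - G x' z) - (G x (fwd _ μ z) - G x z)))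
          + aj ^ 2 * (((n : ℝ)) ^ (d + 1))⁻¹ * ∑ y, (W * (G x' y - G x y)) * ((n : ℝ) * (B y (fwd _ μ z) - B y z)))
      ≤ wsum2 δ' n x x' (fun z => W * ((n : ℝ) * ((G x' (fwd _ μ z) - G x' z) - (G x (fwd _ μ z) - G x z))))
        + wsum2 δ' n x x' (fun z => aj ^ 2 * (((n : ℝ)) ^ (d + 1))⁻¹
            * ∑ y, (W * (G x' y - G x y)) * ((n : ℝ) * (B y (fwd _ μ z) - B y z))) := wsum2_add_le _ _ _ _ _ _
    _ ≤ c₁ + aj ^ 2 * (((n : ℝ)) ^ (d + 1))⁻¹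
        * (cL * (c * Real.exp δ' * (((n : ℝ)) ^ (d + 1) * latticeConst (d + 1) (δ / 2)) * c₂)) := by
        have h2nd : wsum2 δ' n x x' (fun z => aj ^ 2 * (((n : ℝ)) ^ (d + 1))⁻¹
            * ∑ y, (W * (G x' y - G x y)) * ((n : ℝ) * (B y (fwd _ μ z) - B y z)))
            ≤ aj ^ 2 * (((n : ℝ)) ^ (d + 1))⁻¹
              * (cL * (c * Real.exp δ' * (((n : ℝ)) ^ (d + 1) * latticeConst (d + 1) (δ / 2)) * c₂)) := by
          rw [wsum2_mul_left _ _ _ _ (by positivity)]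
          exact mul_le_mul_of_nonneg_left hvm (by positivity)
        exact add_le_add hD' h2nd
    _ = c₁ + aj ^ 2 * (cL * ((c * Real.exp δ' * latticeConst (d + 1) (δ / 2)) * c₂)) := by
        field_simp

/-! ## §3 The column Hölder clause for `G′(□)`, uniformly in the mesh -/

/-- **THE COLUMN HÖLDER CLAUSE FOR THE GENUINE TWO-LEVEL CUBE PROPAGATOR `G′(□)` OF (2.42), UNIFORMLY IN THE MESH —
two-centre weighted form.**  For every dimension, block size, windows and `0 ≤ α < 1` there are `δ′, c′ > 0` such that for
EVERY `j ≥ 1` (`n = L^j`), every point of the windows, every box built of `L`-blocks, EVERY `Λ ⊆ □^{(j)}`, every axis `μ`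
and all `x ≠ x′` of `□`:
`Σ_{z ∈ □} (n/|x′−x|_∞)^α·|n(((G′(□)(x′,fwd_μz) − G′(□)(x′,z)) − (G′(□)(x,fwd_μz) − G′(□)(x,z)))|·e^{δ′min(|x−z|_∞,|x′−z|_∞)/n} ≤ c′`
(the Hölder quotient in `x` of the kernel `z ↦ (G′(□)∂^{ξ*}_μ)(x,z)`).  Inputs BY NAME:
`B4Thm19ZeroBoxHolderDual.thm19Dual_zero_box_roww_coeff`, `B4Lemma22ZeroBoxDerivDual.lemma22_zero_box_Gdstar_roww_coeff`,
`B4Thm110ZeroBox.thm110_zero_box_roww_coeff`, `B4Thm110ZeroBoxDeriv.thm110_zero_box_deriv_roww_coeff`,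
`B4BoxCov237.cov116_box_finset_decay`.  HONEST LABEL: the column companion of the Hölder clause, consumed by the fifth
entry `‖ζG′∇*λ‖_α` of (2.67); (2.43) prints the value/derivative clauses.
[cite: Balaban1984PropagatorsII, (2.42)–(2.43) p.230, Proposition 2.2 (2.67) p.234; Balaban1983RegularityDecay, Theorem (1.9) p.573, (2.40)–(2.41) p.583] -/
theorem ineq243_twoLevel_holderDual_wsum2 (d ℓ : ℕ) (hℓ : 1 ≤ ℓ) (aminus aplus m2plus a2minus a2plus : ℝ)
    (ha : 0 < aminus) (ha2 : 0 < a2minus) (α : ℝ) (hα0 : 0 ≤ α) (hα1 : α < 1) :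
    ∃ δ' c' : ℝ, 0 < δ' ∧ 0 < c' ∧ ∀ (k : ℕ), 1 ≤ k → ∀ (aj m2 a : ℝ), aminus ≤ aj → aj ≤ aplus → 0 ≤ m2 →
      m2 ≤ m2plus → a2minus ≤ a → a ≤ a2plus → ∀ (M' : Fin (d + 1) → ℕ), (∀ i, 1 ≤ M' i) →
        ∀ (Λ : Finset ↥(boxDom (fun i => (ℓ + 1) * M' i))) (μ : Fin (d + 1))
          (x x' : ↥(boxDom (fun i => (ℓ + 1) ^ k * ((ℓ + 1) * M' i)))), x'.1 ≠ x.1 →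
          ∑ z, |((((ℓ + 1) ^ k : ℕ) : ℝ) / supNorm (x'.1 - x.1)) ^ α * ((((ℓ + 1) ^ k : ℕ) : ℝ)
                * ((gTwoLevel ((ℓ + 1) ^ k) ℓ aj a m2 M' Λ x' (fwd _ μ z) - gTwoLevel ((ℓ + 1) ^ k) ℓ aj a m2 M' Λ x' z)
                  - (gTwoLevel ((ℓ + 1) ^ k) ℓ aj a m2 M' Λ x (fwd _ μ z)
                    - gTwoLevel ((ℓ + 1) ^ k) ℓ aj a m2 M' Λ x z)))|
              * Real.exp (δ' * min (supNorm (x.1 - z.1)) (supNorm (x'.1 - z.1)) / (((ℓ + 1) ^ k : ℕ) : ℝ))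
            ≤ c' := by
  obtain ⟨δ₀, c₀, hδ₀, hc₀, hG⟩ := thm110_zero_box_roww_coeff d ℓ hℓ aminus aplus m2plus ha
  obtain ⟨δd, cd, hδd, hcd, hGD⟩ := thm110_zero_box_deriv_roww_coeff d ℓ hℓ aminus aplus m2plus ha
  obtain ⟨δ₂, c₂, hδ₂, hc₂, hG2⟩ := lemma22_zero_box_Gdstar_roww_coeff d ℓ hℓ aminus aplus m2plus ha
  obtain ⟨δ₁, c₁, hδ₁, hc₁, hGT⟩ := thm19Dual_zero_box_roww_coeff d ℓ hℓ aminus aplus m2plus ha α hα0 hα1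
  obtain ⟨δ, c, hδ, hc, hC⟩ := cov116_box_finset_decay d ℓ hℓ aminus aplus m2plus a2minus a2plus ha ha2
  -- the common rate
  set δ' : ℝ := min (min (min δ₀ δd) (min δ₁ δ₂)) (δ / 2) with hδ'
  have hδ'pos : 0 < δ' := lt_min (lt_min (lt_min hδ₀ hδd) (lt_min hδ₁ hδ₂)) (half_pos hδ)
  have hd0 : δ' ≤ δ₀ := (min_le_left _ _).trans ((min_le_left _ _).trans (min_le_left _ _))
  have hdd : δ' ≤ δd := (min_le_left _ _).trans ((min_le_left _ _).trans (min_le_right _ _))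
  have hd1 : δ' ≤ δ₁ := (min_le_left _ _).trans ((min_le_right _ _).trans (min_le_left _ _))
  have hd2 : δ' ≤ δ₂ := (min_le_left _ _).trans ((min_le_right _ _).trans (min_le_right _ _))
  have hd3 : δ' ≤ δ / 2 := min_le_right _ _
  have hKn : 0 ≤ latticeConst (d + 1) (δ / 2) := latticeConst_nonneg (d + 1) (half_pos hδ).le
  set cL : ℝ := 2 * c₀ + ((d : ℝ) + 1) * Real.exp δ' * cd with hcL
  have hcL0 : 0 ≤ cL := by positivity
  refine ⟨δ', c₁ + aplus ^ 2 * (cL * ((c * Real.exp δ' * latticeConst (d + 1) (δ / 2)) * c₂)), hδ'pos,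
    by positivity, ?_⟩
  intro k hk aj m2 a h1 h2 h3 h4 h5 h6 M' hM Λ μ x x' hne
  have hn1 : 1 ≤ (ℓ + 1) ^ k := Nat.one_le_pow _ _ (by omega)
  have hMℓ : ∀ i, 1 ≤ (ℓ + 1) * M' i := fun i => by nlinarith [hM i]
  have haj : 0 < aj := lt_of_lt_of_le ha h1
  -- rows of `G` and of the column-differenced `G`, at the common rate
  have hGz : ∀ z, roww δ' ((ℓ + 1) ^ k) (boxOpR ((ℓ + 1) ^ k) aj m2 (fun i => (ℓ + 1) * M' i))⁻¹ z ≤ c₀ :=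
    fun z => (roww_mono hd0 _ _ z).trans (hG k hk aj m2 h1 h2 h3 h4 (fun i => (ℓ + 1) * M' i) hMℓ z)
  have hGdz : ∀ y, roww δ₂ ((ℓ + 1) ^ k) (Matrix.of fun w z => (((ℓ + 1) ^ k : ℕ) : ℝ) *
      ((boxOpR ((ℓ + 1) ^ k) aj m2 (fun i => (ℓ + 1) * M' i))⁻¹ w (fwd _ μ z)
        - (boxOpR ((ℓ + 1) ^ k) aj m2 (fun i => (ℓ + 1) * M' i))⁻¹ w z)) y ≤ c₂ := by
    intro y
    have := hG2 k hk aj m2 h1 h2 h3 h4 (fun i => (ℓ + 1) * M' i) hMℓ μ y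
    unfold roww
    simpa only [Matrix.of_apply] using this
  -- the Hölder-weighted long row difference of `G`
  have hdiff : ∀ (i : Fin (d + 1)) (u ue : ↥(boxDom (fun i => (ℓ + 1) ^ k * ((ℓ + 1) * M' i)))),
      ue.1 = u.1 + Pi.single i 1 →
      wsum δ' ((ℓ + 1) ^ k) u (fun c => (((ℓ + 1) ^ k : ℕ) : ℝ) *
        ((boxOpR ((ℓ + 1) ^ k) aj m2 (fun i => (ℓ + 1) * M' i))⁻¹ ue c
          - (boxOpR ((ℓ + 1) ^ k) aj m2 (fun i => (ℓ + 1) * M' i))⁻¹ u c)) ≤ cd := by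
    intro i u ue hue
    refine (wsum_mono hdd _ _ _).trans ?_
    have := hGD k hk aj m2 h1 h2 h3 h4 (fun i => (ℓ + 1) * M' i) hMℓ i u ue hue
    unfold wsum
    exact this
  have hLx := wsum2_longRow_holder_le hδ'pos.le hn1 (boxOpR ((ℓ + 1) ^ k) aj m2 (fun i => (ℓ + 1) * M' i))⁻¹
    hc₀.le hcd.le hGz hdiff hα0 hα1.le x x' hne
  -- the column Hölder clause for `G`
  have hGTx : wsum2 δ₁ ((ℓ + 1) ^ k) x x' (fun z => ((((ℓ + 1) ^ k : ℕ) : ℝ) / supNorm (x'.1 - x.1)) ^ α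
      * (((((ℓ + 1) ^ k : ℕ)) : ℝ) * (((boxOpR ((ℓ + 1) ^ k) aj m2 (fun i => (ℓ + 1) * M' i))⁻¹ x' (fwd _ μ z)
        - (boxOpR ((ℓ + 1) ^ k) aj m2 (fun i => (ℓ + 1) * M' i))⁻¹ x' z)
        - ((boxOpR ((ℓ + 1) ^ k) aj m2 (fun i => (ℓ + 1) * M' i))⁻¹ x (fwd _ μ z)
        - (boxOpR ((ℓ + 1) ^ k) aj m2 (fun i => (ℓ + 1) * M' i))⁻¹ x z)))) ≤ c₁ :=
    hGT k hk aj m2 h1 h2 h3 h4 (fun i => (ℓ + 1) * M' i) hMℓ μ x x' hne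
  have hCz := (hC ((ℓ + 1) ^ k) hn1 aj m2 a h1 h2 h3 h4 h5 h6 M' hM Λ).2
  have hmain := gTwoLevel_holderDual_wsum2_le hn1 aj a m2 Λ μ hc₂.le hc.le hδ hδ'pos.le hd1 hd2 hd3 hGdz hCz
    _ x x' hLx hGTx
  rw [wsum2] at hmain
  refine hmain.trans ?_
  have : aj ^ 2 ≤ aplus ^ 2 := pow_le_pow_left₀ haj.le h2 2
  have h0 : 0 ≤ cL * ((c * Real.exp δ' * latticeConst (d + 1) (δ / 2)) * c₂) := by positivity
  nlinarith

/-! ## §4 Non-vacuity -/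

/-- the hypotheses of the column Hölder clause are inhabited: `d + 1 = 4`, `L = 2`, unit windows, `α = 1/2`.
[cite: Balaban1984PropagatorsII, (2.43) p.230] -/
example : ∃ δ' c' : ℝ, 0 < δ' ∧ 0 < c' ∧ ∀ (k : ℕ), 1 ≤ k → ∀ (aj m2 a : ℝ), (1 : ℝ) ≤ aj → aj ≤ 1 → 0 ≤ m2 →
      m2 ≤ 1 → (1 : ℝ) ≤ a → a ≤ 1 → ∀ (M' : Fin (3 + 1) → ℕ), (∀ i, 1 ≤ M' i) →
        ∀ (Λ : Finset ↥(boxDom (fun i => (1 + 1) * M' i))) (μ : Fin (3 + 1))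
          (x x' : ↥(boxDom (fun i => (1 + 1) ^ k * ((1 + 1) * M' i)))), x'.1 ≠ x.1 →
          ∑ z, |((((1 + 1) ^ k : ℕ) : ℝ) / supNorm (x'.1 - x.1)) ^ (1 / 2 : ℝ) * ((((1 + 1) ^ k : ℕ) : ℝ)
                * ((gTwoLevel ((1 + 1) ^ k) 1 aj a m2 M' Λ x' (fwd _ μ z) - gTwoLevel ((1 + 1) ^ k) 1 aj a m2 M' Λ x' z)
                  - (gTwoLevel ((1 + 1) ^ k) 1 aj a m2 M' Λ x (fwd _ μ z)
                    - gTwoLevel ((1 + 1) ^ k) 1 aj a m2 M' Λ x z)))|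
              * Real.exp (δ' * min (supNorm (x.1 - z.1)) (supNorm (x'.1 - z.1)) / (((1 + 1) ^ k : ℕ) : ℝ))
            ≤ c' :=
  ineq243_twoLevel_holderDual_wsum2 3 1 le_rfl 1 1 1 1 1 one_pos one_pos (1 / 2) (by norm_num) (by norm_num)

end

end Literature.MathematicalPhysics.QuantumFieldTheory.Balaban1983to89.B6Ineq243HolderDualTwoLevelBox
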